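import Literature.MathematicalPhysics.QuantumFieldTheory.Balaban1983to89.B4Lemma22HolderCubeField
import Literature.MathematicalPhysics.QuantumFieldTheory.Balaban1983to89.B4Lemma22BoxNoCollar

/-!
# `Balaban1983to89.B4Lemma22HolderNoCollar` — [Balaban1983RegularityDecay] LEMMA 2.2 (2.16), THE HÖLDER MEMBER
# «‖G_k(□,Ã)f‖_{1,α} ≤ c₁‖f‖_∞», FOR `G_k(□, A)` AT A (1.7)-REGULAR FIELD `A` ON A BOX WITH **NO COLLAR HYPOTHESIS**

statement-level skeleton of published theorems with citation tags; proofs where landed; nothing here is a claim about the Yang–Mills mass gap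

CITATION HEADER.  T. Bałaban, *Regularity and decay of lattice Green's functions*, Commun. Math. Phys. **89** (1983)
571–597, doi:10.1007/bf01214744 [Balaban1983RegularityDecay] (cell paper B4; held text
`paper:balaban1983-cmp89-regularity-decay`, journal page = PDF page + 570; pp. 572–573, 575, 577–582).  Unit
`lit-balaban-r04` gen 15 (B4 second reader; HOME `run/shared/lean/pub/lit-balaban/`), SKELETON rows **B4.Lem2.2**
((2.16), the Hölder member), **B4.Thm@573** (the per-cube Hölder input `hHG` of `B4Thm19BoxHolderCut.thm19_holder_boxCut`
at the BOUNDARY cubes); HOME/GAPS.md **G-B4-p17-02** (collar-drop programme, the Hölder member).  Imports p35 g7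
`B4Lemma22HolderCubeField` (→ b04 `B4Lemma22HolderBox.lemma22_16_holder_field`, `IsNNChain`; `holder_gauge`;
`B4Lemma22Invertible.opA_stair_isUnit_det`) and r04 g15 `B4Lemma22BoxNoCollar` (`firstOrderSmall_cross_face`,
`gBond`/`gSig`/`bondGauge_gBond`/`gBond_step`/`gBond_hyps`, `gauged_abs_le`, `noCollar_threshold`).

WHAT IS PRINTED.  p. 577, Lemma 2.2 (statement and (2.16) on p. 577, text layer `p0007.txt` L32–37; (2.17) on
p. 578): «‖G_k(□,Ã)f‖_{1,α} ≤ c₁‖f‖_∞ (2.16)» with the norm (2.14) of p. 577 (the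
`α`-Hölder quotient of `D^η_Ã G f` formed with the transport `U(Ã(Γ_{x,x′}))`), for «Ã … constant in a neighbourhood
of the boundary of □»; p. 581 (2.32) «Only here we needed the assumption that Ã is constant in a neighbourhood of
∂□»; p. 579 «if Ω is a rectangular parallelepiped, then all □_j … are cubes and we can apply Lemma 2.2 to all
operators in it»; p. 572 (1.7) «|(∂^η_μA)(x)| ≤ ce^{β−1}, x∈Ω, μ=1,…,d, β>0» (the last display of p. 572;
its closing words «and c is some universal constant» open p. 573).

THE POINT (as in `B4Lemma22BoxNoCollar`, analysis ours, disclosed).  The tree's kernel proof of the Hölder member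
(`B4Lemma22HolderBox.lemma22_16_holder_field_explicit`) uses «A' has a compact support in □» ONLY through
`B4Lemma22CrossSup.firstOrderSmall_cross` (the divergence term of (2.32)); with the face bound `|κA'_μ| ≤ θ_fη²`
on the face-touching normal bonds instead (`firstOrderSmall_cross_face`) the member holds verbatim (§1).  The extra
input of the Hölder member, the transverse Lipschitz bound `|κ(A'_μ(x′) − A'_μ(x))| ≤ θ'|x′−x|_∞η²`, holds for the
Neumann-gauged field by `gauged_regular` along two staircases through `x ⊓ x′` inside the set of sites whose forward
`μ`-bond lies in the box (§2, `θ' = 2(d+1)C₁(d)ce^β`).  Gauging back (`holder_gauge`, `transport_gauge`) gives the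
member for `G_k(□, A)` at the (1.7)-regular `A` itself, no collar (§4).

WHAT THIS MODULE PROVES (all in full).
* §1 **`lemma22_16_holder_field_explicit_face`** — (2.16) at `Ã = A₀ + A'` with the face bound in place of
  «compact support».
* §2 `gauged_transverse` — `|A''_ν(x′) − A''_ν(x)| ≤ 2(d+1)|x′−x|_∞·C₁(d)κ` on the `ν`-bonds of the box;
  `holder_noCollar_threshold`.
* §3 **`lemma22_holder_noCollar`** — for EVERY (1.7)-regular component field `A` on a box of sides `M_μ ≤ S`
  (`nM_μ ≥ 3`), `0 < e ≤ e₁(c, β, S)`, every `μ`, sites `x ≠ x′` whose forward `μ`-bonds lie in `□`, every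
  nearest-neighbour chain `Γ` from `x` to `x′` with `|Γ| ≤ (d+1)|x′−x|_∞`, every `Φ`:
  `(n/|x′−x|_∞)^α·|U(A(Γ))(D^η_{A,μ}G_k(□,A)Φ)(x′) − (D^η_{A,μ}G_k(□,A)Φ)(x)| ≤ C‖Φ‖_∞` (`0 ≤ α < 1`).
HONEST SCOPE.  (i) As `B4Lemma22HolderBox`: the lineage's abelian one-parameter flow, boxes, corner embedding and
staircase contours, chains with `|Γ| ≤ (d+1)|x′−x|_∞`, `0 ≤ α < 1`; (ii) constants: `C` on
`(d, N, ℓ₁, L, a₋, a₊, m²₊, α)`, `e₁` on these and `(c, β, S)`; (iii) the gauge `λ` is ours (`B4BoxNeumannGauge`).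
Theorems only; no `def`, no `Prop` fact, no `sorry`; axioms standard.
v1.1 (unit `lit-balaban-r04` gen 17, DOCSTRING-ONLY; every declaration byte-identical with v1.0 p327564): the locator of
Lemma 2.2 / (2.16) corrected from "p. 578" to p. 577 in this header and in two `[cite:]` tags (referee ref-4 NOTE
S-B4-g45-1; print re-read on the ×2 render `…/1983-cmp89-regularity-decay-p007-x2.png`: Lemma 2.2 and (2.16) stand at the
foot of p. 577, (2.17) at the head of p. 578); likewise "(2.23) p. 580" → p. 579 in one tag (render `-p009-x2.png`), and the
guillemets around our own wording of the tree hypothesis `hbd` in §1's docstring replaced by plain quotes (guillemets mark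
printed text only).
v1.2 (unit `lit-balaban-r04` gen 20, DOCSTRING-ONLY; every declaration byte-identical with v1.1 p332158): the locator of
(1.7) corrected from "p. 573" to p. 572 in this header and in four `[cite:]` tags (summit-lit1 CITELOC register row
P69-003; print re-read on the ×2 renders `…/1983-cmp89-regularity-decay-p002-x2.png` / `-p003-x2.png`: (1.7) is the last
display of p. 572; (1.8) and the Theorem with (1.9)–(1.12) stand on p. 573).
-/

namespace Literature.MathematicalPhysics.QuantumFieldTheory.Balaban1983to89.B4Lemma22HolderNoCollar

open Finset Matrix
open Literature.MathematicalPhysics.QuantumFieldTheory.Balaban1983to89.B4GaugeCovariance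
open Literature.MathematicalPhysics.QuantumFieldTheory.Balaban1983to89.B4Reflection242 (boxDom nbrs mem_boxDom mem_nbrs)
open Literature.MathematicalPhysics.QuantumFieldTheory.Balaban1983to89.B4Lower18Regular (e1 e1_apply_self e1_apply_ne
  baseEmb stairContour stair pathEnd_stair length_stair_le mem_stair mem_boxDom_of_between lsum stairContour_end
  pertE crossOp)
open Literature.MathematicalPhysics.QuantumFieldTheory.Balaban1983to89.B4Lower18RegularRegion (compField
  pathRel_stairL_up pathRel_and pathRel_chain abs_sub_le_of_pathRel)
open Literature.MathematicalPhysics.QuantumFieldTheory.Balaban1983to89.B4Lemma21Region (siteNorm covDeriv)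
open Literature.MathematicalPhysics.QuantumFieldTheory.Balaban1983to89.B4ContourShift (supNorm supNorm_nonneg
  exists_supNorm_eq abs_le_supNorm)
open Literature.MathematicalPhysics.QuantumFieldTheory.Balaban1983to89.B4Lemma22Reduce231 (supN supN_nonneg
  FirstOrderSmall)
open Literature.MathematicalPhysics.QuantumFieldTheory.Balaban1983to89.B4Lemma22ReduceZero (Box opA greenA derivA
  derivA0 pertV siteNorm_gauge_mulVec supN_gauge_transpose conj_mul_conj covDeriv_gauge)
open Literature.MathematicalPhysics.QuantumFieldTheory.Balaban1983to89.B4Lemma22PertVSup (firstOrderSmall_pertV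
  constBond_antisymm)
open Literature.MathematicalPhysics.QuantumFieldTheory.Balaban1983to89.B4Lemma22SupStair (stair_lsum_le)
open Literature.MathematicalPhysics.QuantumFieldTheory.Balaban1983to89.B4Lemma22Invertible (opA_stair_isUnit_det)
open Literature.MathematicalPhysics.QuantumFieldTheory.Balaban1983to89.B4Lemma22HolderBox (IsNNChain
  lemma22_16_holder_field)
open Literature.MathematicalPhysics.QuantumFieldTheory.Balaban1983to89.B4Lemma22HolderCubeField (holder_gauge)
open Literature.MathematicalPhysics.QuantumFieldTheory.Balaban1983to89.B4CubeFieldHyps22 (fieldLink_smul greenA_smul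
  cube_threshold aSeq_window)
open Literature.MathematicalPhysics.QuantumFieldTheory.Balaban1983to89.B4BoxNeumannGauge (gauged gaugeFn C1 C2
  gauged_regular)
open Literature.MathematicalPhysics.QuantumFieldTheory.Balaban1983to89.B4Lemma22BoxNoCollar (firstOrderSmall_cross_face
  gSig gBond bondGauge_gBond gBond_step gBond_hyps noCollar_threshold)

noncomputable section

variable {d : ℕ}

/-! ## §1. (2.16) at `Ã = A₀ + A'` with the face bound in place of «compact support» -/

section Face

variable {ι : Type} [Fintype ι] [DecidableEq ι]

/-- **LEMMA 2.2 (2.16), THE HÖLDER MEMBER, AT `Ã = A₀ + A'`, FACE VERSION** —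
`B4Lemma22HolderBox.lemma22_16_holder_field_explicit` with "A' = 0 on the `μ`-bonds touching the `μ`-faces" (the tree's hypothesis `hbd`, our wording) replaced
by `|κA'| ≤ θ_f/n²` there (both orientations) and the smallness slot `(d+1)ℓ₁(θ + (θ₂ + θ_f))`; all other hypotheses
(invertibility, size `θ ≤ 1`, `|κA₀,ν| ≤ θ/n`, transverse Lipschitz `θ' ≤ 1`, second differences `θ₂`, contour sums
`τ`) as there.  Conclusion: the transported Hölder quotient of `D^η_{Ã,μ}G_k(□,Ã)Φ` along any nearest-neighbour chain
of length `≤ (d+1)|x′−x|_∞` is `≤ 2c₁‖Φ‖_∞`.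
[cite: Balaban1983RegularityDecay, Lemma 2.2 (2.16) p. 577; (2.23) p. 579; (2.31)–(2.33) p. 581] -/
theorem lemma22_16_holder_field_explicit_face (F : OrthFlow ι) {ℓ₁ : ℝ} (hℓ₁ : 0 ≤ ℓ₁)
    (hLip : ∀ t (v : ι → ℝ), ((F.U t - 1) *ᵥ v) ⬝ᵥ ((F.U t - 1) *ᵥ v) ≤ (ℓ₁ * t) ^ 2 * (v ⬝ᵥ v))
    (κ : ℝ) (d ℓ : ℕ) (hℓ : 1 ≤ ℓ) (amin aplus m2plus : ℝ) (ha : 0 < amin) (α : ℝ) (hα0 : 0 ≤ α)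
    (hα1 : α < 1) :
    ∃ c c₁ : ℝ, 0 < c ∧ 0 < c₁ ∧ ∀ (k : ℕ), 1 ≤ k → ∀ (a m2 : ℝ), amin ≤ a → a ≤ aplus → 0 ≤ m2 → m2 ≤ m2plus →
      ∀ (M : Fin (d + 1) → ℕ), (∀ i, 1 ≤ M i) →
      ∀ (emb : ↥(boxDom M) → ↥(Box d ℓ k M)) (Γ : ↥(boxDom M) → ↥(Box d ℓ k M) → List ↥(Box d ℓ k M)),
        (∀ y x, blkWt ((ℓ + 1) ^ k) M (fun i => (ℓ + 1) ^ k * M i) y x ≠ 0 → pathEnd (emb y) (Γ y x) = x) →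
      ∀ (A₀ : Fin (d + 1) → ℝ) (A' : ↥(Box d ℓ k M) → ↥(Box d ℓ k M) → ℝ) (θ θ' θ₂ θf τ : ℝ),
        IsUnit (opA d F κ ℓ k a m2 M emb Γ (constBond A₀ Subtype.val + A')).det →
        0 ≤ θ → θ ≤ 1 → (∀ ν, |κ * A₀ ν| ≤ θ / ((ℓ + 1) ^ k : ℕ)) →
        (∀ x y : ↥(Box d ℓ k M), y.1 ∈ nbrs x.1 → |κ * A' x y| ≤ θ / ((ℓ + 1) ^ k : ℕ)) →
        0 ≤ θ' → θ' ≤ 1 →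
        (∀ (μ : Fin (d + 1)) (x xe x' xe' : ↥(Box d ℓ k M)), xe.1 = x.1 + e1 μ → xe'.1 = x'.1 + e1 μ →
          |κ * (A' x' xe' - A' x xe)|
            ≤ θ' * supNorm (x'.1 - x.1) / (((ℓ + 1) ^ k : ℕ) : ℝ) ^ 2) →
        0 ≤ θ₂ → (∀ (x z y : ↥(Box d ℓ k M)) (μ : Fin (d + 1)), z.1 = x.1 + e1 μ → y.1 = z.1 + e1 μ →
          |κ * (A' y z - A' z x)| ≤ θ₂ / (((ℓ + 1) ^ k : ℕ) : ℝ) ^ 2 ∧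
          |κ * (A' x z - A' z y)| ≤ θ₂ / (((ℓ + 1) ^ k : ℕ) : ℝ) ^ 2) →
        0 ≤ θf → (∀ (x y : ↥(Box d ℓ k M)) (μ : Fin (d + 1)), y.1 = x.1 + e1 μ →
          (x.1 - e1 μ ∉ Box d ℓ k M ∨ y.1 + e1 μ ∉ Box d ℓ k M) →
          |κ * A' x y| ≤ θf / (((ℓ + 1) ^ k : ℕ) : ℝ) ^ 2 ∧ |κ * A' y x| ≤ θf / (((ℓ + 1) ^ k : ℕ) : ℝ) ^ 2) →
        0 ≤ τ → (∀ y x, blkWt ((ℓ + 1) ^ k) M (fun i => (ℓ + 1) ^ k * M i) y x ≠ 0 →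
          |κ * lsum A' (emb y) (Γ y x)| ≤ τ) →
        ((d : ℝ) + 2) * c * (((d : ℝ) + 1) * ℓ₁ * (θ + (θ₂ + θf)) + ((d : ℝ) + 1) * ℓ₁ * θ
          + ((d : ℝ) + 1) * ℓ₁ ^ 2 * θ ^ 2 + B1.aSeq a ((ℓ : ℝ) + 1) k * (ℓ₁ * τ * (2 + ℓ₁ * τ))) ≤ 1 / 2 →
      ∀ (μ : Fin (d + 1)) (x xe x' xe' : ↥(Box d ℓ k M)),
        xe.1 = x.1 + e1 μ → xe'.1 = x'.1 + e1 μ → x'.1 ≠ x.1 →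
      ∀ (l : List ↥(Box d ℓ k M)), IsNNChain x l → pathEnd x l = x' →
        (l.length : ℝ) ≤ ((d : ℝ) + 1) * supNorm (x'.1 - x.1) →
      ∀ Φ : ↥(Box d ℓ k M) × ι → ℝ,
        ((((ℓ + 1) ^ k : ℕ) : ℝ) / supNorm (x'.1 - x.1)) ^ α *
          siteNorm (transport (fieldLink F κ (constBond A₀ Subtype.val + A')) x l
              *ᵥ fld (derivA d F κ ℓ k M (constBond A₀ Subtype.val + A') μ
                    *ᵥ (greenA d F κ ℓ k a m2 M emb Γ (constBond A₀ Subtype.val + A') *ᵥ Φ)) x'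
            - fld (derivA d F κ ℓ k M (constBond A₀ Subtype.val + A') μ
                    *ᵥ (greenA d F κ ℓ k a m2 M emb Γ (constBond A₀ Subtype.val + A') *ᵥ Φ)) x)
          ≤ 2 * c₁ * supN Φ := by
  obtain ⟨c, c₁, hc, hc₁, h⟩ := lemma22_16_holder_field F hℓ₁ hLip κ d ℓ hℓ amin aplus m2plus ha α hα0 hα1
  refine ⟨c, c₁, hc, hc₁, ?_⟩
  intro k hk a m2 e1' e2 e3 e4 M hM emb Γ hend A₀ A' θ θ' θ₂ θf τ hunit hθ hθ1 hA0 hA' hθ' hθ'1 hA'' hθ₂ hder hθf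
    hface hτ0 hτ hsm μ x xe x' xe' hxe hxe' hne l hl hlend hlen Φ
  have hn : 1 ≤ (ℓ + 1) ^ k := Nat.one_le_pow _ _ (Nat.succ_pos ℓ)
  have hL : (1 : ℝ) < (ℓ : ℝ) + 1 := by
    have : (1 : ℝ) ≤ (ℓ : ℝ) := by exact_mod_cast hℓ
    linarith
  have ha' : 0 < a := lt_of_lt_of_le ha e1'
  have hak : 0 ≤ B1.aSeq a ((ℓ : ℝ) + 1) k := (B1.aSeq_pos ha' hL hk).le
  have hC := firstOrderSmall_cross_face F hℓ₁ hLip κ hn (fun i => (ℓ + 1) ^ k * M i) (constBond A₀ Subtype.val)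
    (constBond_antisymm A₀ Subtype.val) hθ hA' hθ₂ hθf hder hface
  have hV := firstOrderSmall_pertV F hℓ₁ hLip κ hℓ hk ha' M emb Γ A₀ hθ hA' hτ0 hτ hC
  have hε : 0 ≤ ((d : ℝ) + 1) * ℓ₁ * (θ + (θ₂ + θf)) + ((d : ℝ) + 1) * ℓ₁ * θ + ((d : ℝ) + 1) * ℓ₁ ^ 2 * θ ^ 2
      + B1.aSeq a ((ℓ : ℝ) + 1) k * (ℓ₁ * τ * (2 + ℓ₁ * τ)) := by positivity
  exact h k hk a m2 e1' e2 e3 e4 M hM emb Γ hend A₀ A' θ θ' _ hθ hθ1 hθ' hθ'1 hA0 hA' hA'' hunit hV hε hsm μ x xe x'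
    xe' hxe hxe' hne l hl hlend hlen Φ

end Face

/-! ## §2. The transverse Lipschitz bound of the Neumann-gauged field; the threshold -/

section Transverse

variable {N : Fin (d + 1) → ℕ}

/-- `C₁(d) ≥ 0`. [cite: Balaban1983RegularityDecay, (1.7) p. 572, dictionary] -/
private theorem C1_nonneg (d : ℕ) : 0 ≤ C1 d := by unfold C1; positivity

/-- `C₂(d) ≥ 0`. [cite: Balaban1983RegularityDecay, (1.7) p. 572, dictionary] -/
private theorem C2_nonneg (d : ℕ) : 0 ≤ C2 d := by unfold C2; positivity

/-- telescoping along the up-going staircase from `m` to `x ≥ m` inside a box, for any function with a step bound on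
the bonds of the box: `|f(x) − f(m)| ≤ (d+1)·Kz·b` when `x_i − m_i ≤ Kz`.
[cite: Balaban1983RegularityDecay, §2 p. 575 «A′ is regular», dictionary] -/
private theorem abs_sub_le_of_steps {f : (Fin (d + 1) → ℤ) → ℝ} {b : ℝ} (hb : 0 ≤ b)
    (hstep : ∀ p ∈ boxDom N, ∀ μ, p + e1 μ ∈ boxDom N → |f (p + e1 μ) - f p| ≤ b)
    {m x : Fin (d + 1) → ℤ} (hm : m ∈ boxDom N) (hx : x ∈ boxDom N) (hle : m ≤ x) {Kz : ℤ}
    (hK : ∀ i, x i - m i ≤ Kz) : |f x - f m| ≤ ((d : ℝ) + 1) * Kz * b := by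
  have hup : B4Lower18Regular.PathRel (fun u v : Fin (d + 1) → ℤ => ∃ μ, v = u + e1 μ) m (stair m x) :=
    pathRel_stairL_up x (List.finRange (d + 1)) m
  have hmem : ∀ z ∈ stair m x, z ∈ boxDom N := fun z hz =>
    mem_boxDom_of_between hm hx (mem_stair hle hz).1 (mem_stair hle hz).2
  have hpath := pathRel_chain (r := fun u v : Fin (d + 1) → ℤ => ∃ μ, v = u + e1 μ)
    (P := fun z => z ∈ boxDom N) _ _ hm (pathRel_and _ _ hup hmem)
  have hst : ∀ p q : Fin (d + 1) → ℤ,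
      (p ∈ boxDom N ∧ ((∃ μ, q = p + e1 μ) ∧ q ∈ boxDom N)) → |f q - f p| ≤ b := by
    rintro p q ⟨hp, ⟨μ, rfl⟩, hq⟩
    exact hstep p hp μ hq
  have htel := abs_sub_le_of_pathRel (f := f) hst _ _ hpath
  rw [pathEnd_stair hle] at htel
  have hlen : ((stair m x).length : ℝ) ≤ ((d : ℝ) + 1) * Kz := by
    have h := length_stair_le hle (K := Kz) hK
    exact_mod_cast h
  exact htel.trans (mul_le_mul_of_nonneg_right hlen hb)

/-- the coordinatewise minimum of two box sites is a box site. [cite: Balaban1983RegularityDecay, p. 584 «□ = {x ∈ ξZ^d : 0 ≤ x_μ ≤ M_μ}», dictionary] -/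
private theorem inf_mem_boxDom {x x' : Fin (d + 1) → ℤ} (hx : x ∈ boxDom N) (hx' : x' ∈ boxDom N) :
    x ⊓ x' ∈ boxDom N := by
  rw [mem_boxDom] at hx hx' ⊢
  intro i
  rw [Pi.inf_apply]
  exact ⟨le_inf (hx i).1 (hx' i).1, lt_of_le_of_lt inf_le_left (hx i).2⟩

/-- `x_i − (x ⊓ x′)_i ≤ |x′ − x|_∞`. [cite: Balaban1983RegularityDecay, p. 573 «dist», dictionary] -/
private theorem sub_inf_le_supNorm (x x' : Fin (d + 1) → ℤ) {Kz : ℤ} (hKz : supNorm (x' - x) = ((Kz : ℤ) : ℝ))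
    (i : Fin (d + 1)) : x i - (x ⊓ x') i ≤ Kz ∧ x' i - (x ⊓ x') i ≤ Kz := by
  have h1 : (((|(x' - x) i| : ℤ)) : ℝ) ≤ supNorm (x' - x) := abs_le_supNorm (x' - x) i
  rw [hKz] at h1
  have h2 : |(x' - x) i| ≤ Kz := by exact_mod_cast h1
  rw [Pi.sub_apply, abs_le] at h2
  rw [Pi.inf_apply]
  constructor
  · rcases le_total (x i) (x' i) with h | h
    · rw [inf_eq_left.2 h]; omega
    · rw [inf_eq_right.2 h]; omega
  · rcases le_total (x i) (x' i) with h | h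
    · rw [inf_eq_left.2 h]; omega
    · rw [inf_eq_right.2 h]; omega

/-- the sites whose forward `ν`-bond lies in the box form the box with the `ν`-side shortened by one.
[cite: Balaban1983RegularityDecay, p. 584 «□ = {x ∈ ξZ^d : 0 ≤ x_μ ≤ M_μ}», dictionary] -/
private theorem mem_shrink_iff {ν : Fin (d + 1)} (hN : 1 ≤ N ν) {z : Fin (d + 1) → ℤ} :
    z ∈ boxDom (Function.update N ν (N ν - 1)) ↔ z ∈ boxDom N ∧ z + e1 ν ∈ boxDom N := by
  simp only [mem_boxDom]
  have hcast : ((N ν - 1 : ℕ) : ℤ) = (N ν : ℤ) - 1 := by omega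
  constructor
  · intro h
    refine ⟨fun i => ?_, fun i => ?_⟩
    · by_cases hiv : i = ν
      · rw [hiv]
        have hi := h ν
        rw [Function.update_apply, if_pos rfl, hcast] at hi
        omega
      · have hi := h i
        rw [Function.update_apply, if_neg hiv] at hi
        exact hi
    · by_cases hiv : i = ν
      · rw [hiv]
        have hi := h ν
        rw [Function.update_apply, if_pos rfl, hcast] at hi
        simp only [Pi.add_apply, e1_apply_self]
        omega
      · have hi := h i
        rw [Function.update_apply, if_neg hiv] at hi
        simp only [Pi.add_apply, e1_apply_ne hiv, add_zero]
        exact hi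
  · rintro ⟨h1, h2⟩ i
    by_cases hiv : i = ν
    · rw [hiv]
      have a := h1 ν
      have b := h2 ν
      simp only [Pi.add_apply, e1_apply_self] at b
      rw [Function.update_apply, if_pos rfl, hcast]
      omega
    · rw [Function.update_apply, if_neg hiv]
      exact h1 i

/-- **THE TRANSVERSE LIPSCHITZ BOUND OF THE NEUMANN-GAUGED FIELD** («A′ is regular», every direction): for a field
(1.7)-regular (`κ ≥ 0`) on the fine box `Π[0,N_μ)` (`N_μ ≥ 3`) and any two sites `x, x′` whose forward `ν`-bonds
lie in the box, `|A''_ν(x′) − A''_ν(x)| ≤ 2(d+1)|x′ − x|_∞·C₁(d)κ` — two staircases through `x ⊓ x′` inside the box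
with the `ν`-side shortened by one, each step by `gauged_regular`.
[cite: Balaban1983RegularityDecay, (1.7) p. 572; §2 p. 575 «A′ is regular … |∂^η_μA′| ≤ c′e^{β−1}»] -/
theorem gauged_transverse (hN : ∀ μ, 3 ≤ N μ) {Ac : (Fin (d + 1) → ℤ) → Fin (d + 1) → ℝ} {κ : ℝ} (hκ : 0 ≤ κ)
    (hreg : ∀ x ∈ boxDom N, ∀ i ν : Fin (d + 1), |Ac (x + e1 i) ν - Ac x ν| ≤ κ) (ν : Fin (d + 1))
    {x x' : Fin (d + 1) → ℤ} (hx : x ∈ boxDom N) (hxe : x + e1 ν ∈ boxDom N) (hx' : x' ∈ boxDom N)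
    (hx'e : x' + e1 ν ∈ boxDom N) :
    |gauged N Ac x' ν - gauged N Ac x ν| ≤ 2 * (((d : ℝ) + 1) * supNorm (x' - x)) * (C1 d * κ) := by
  set N' : Fin (d + 1) → ℕ := Function.update N ν (N ν - 1) with hN'_def
  have hN1 : 1 ≤ N ν := le_trans (by norm_num) (hN ν)
  have hmem : ∀ z, z ∈ boxDom N' ↔ z ∈ boxDom N ∧ z + e1 ν ∈ boxDom N := fun z => mem_shrink_iff hN1
  have hb : 0 ≤ C1 d * κ := mul_nonneg (C1_nonneg d) hκ
  have hstep : ∀ p ∈ boxDom N', ∀ i, p + e1 i ∈ boxDom N' →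
      |gauged N Ac (p + e1 i) ν - gauged N Ac p ν| ≤ C1 d * κ := by
    intro p hp i hpi
    obtain ⟨hp1, hp2⟩ := (hmem p).1 hp
    obtain ⟨hpi1, hpi2⟩ := (hmem _).1 hpi
    exact gauged_regular hN hreg hp1 hpi1 hp2 hpi2
  obtain ⟨i₀, hi₀⟩ := exists_supNorm_eq (x' - x)
  set Kz : ℤ := |(x' - x) i₀| with hKz_def
  have hxN' : x ∈ boxDom N' := (hmem x).2 ⟨hx, hxe⟩
  have hx'N' : x' ∈ boxDom N' := (hmem x').2 ⟨hx', hx'e⟩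
  have hm : x ⊓ x' ∈ boxDom N' := inf_mem_boxDom hxN' hx'N'
  have h1 : |gauged N Ac x ν - gauged N Ac (x ⊓ x') ν| ≤ ((d : ℝ) + 1) * Kz * (C1 d * κ) :=
    abs_sub_le_of_steps (N := N') (f := fun p => gauged N Ac p ν) hb hstep hm hxN' inf_le_left
      fun i => (sub_inf_le_supNorm x x' hi₀ i).1
  have h2 : |gauged N Ac x' ν - gauged N Ac (x ⊓ x') ν| ≤ ((d : ℝ) + 1) * Kz * (C1 d * κ) :=
    abs_sub_le_of_steps (N := N') (f := fun p => gauged N Ac p ν) hb hstep hm hx'N' inf_le_right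
      fun i => (sub_inf_le_supNorm x x' hi₀ i).2
  have hKs : (((Kz : ℤ)) : ℝ) = supNorm (x' - x) := hi₀.symm
  calc |gauged N Ac x' ν - gauged N Ac x ν|
      = |(gauged N Ac x' ν - gauged N Ac (x ⊓ x') ν) - (gauged N Ac x ν - gauged N Ac (x ⊓ x') ν)| := by ring_nf
    _ ≤ |gauged N Ac x' ν - gauged N Ac (x ⊓ x') ν| + |gauged N Ac x ν - gauged N Ac (x ⊓ x') ν| := abs_sub _ _
    _ ≤ ((d : ℝ) + 1) * Kz * (C1 d * κ) + ((d : ℝ) + 1) * Kz * (C1 d * κ) := add_le_add h2 h1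
    _ = 2 * (((d : ℝ) + 1) * supNorm (x' - x)) * (C1 d * κ) := by rw [← hKs]; ring

/-- **«FOR e SUFFICIENTLY SMALL» FOR THE HÖLDER MEMBER, NO COLLAR**: `B4Lemma22BoxNoCollar.noCollar_threshold` and in
addition `2(d+1)C₁(d)·c·e^β ≤ 1` (the transverse constant of `gauged_transverse` at charge `e/n`).
[cite: Balaban1983RegularityDecay, Theorem p. 573 «for e sufficiently small», p. 581] -/
theorem holder_noCollar_threshold (d : ℕ) {ℓ₁ c amin aplus creg β : ℝ} (hℓ₁ : 0 ≤ ℓ₁) (hc : 0 ≤ c)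
    (ha : 0 < amin) (hcreg : 0 ≤ creg) (hβ : 0 < β) (S : ℕ) :
    ∃ e₁ : ℝ, 0 < e₁ ∧ ∀ e : ℝ, 0 < e → e ≤ e₁ → ∀ ak : ℝ, 3 / 4 * amin ≤ ak → ak ≤ aplus →
      (C2 d + S * C1 d) * creg * e ^ β ≤ 1 ∧
      2 * ((d : ℝ) + 1) * C1 d * creg * e ^ β ≤ 1 ∧
      ℓ₁ ^ 2 * ((C2 d + S * C1 d) * creg * e ^ β) ^ 2 * ((d : ℝ) + 1) * (1 + ak * ((d : ℝ) + 1))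
        ≤ min 2 ak / 4 ∧
      ((d : ℝ) + 2) * c * (((d : ℝ) + 1) * ℓ₁ * ((C2 d + S * C1 d) * creg * e ^ β
          + (C1 d * creg * e ^ β + C2 d * creg * e ^ β))
        + ((d : ℝ) + 1) * ℓ₁ * ((C2 d + S * C1 d) * creg * e ^ β)
        + ((d : ℝ) + 1) * ℓ₁ ^ 2 * ((C2 d + S * C1 d) * creg * e ^ β) ^ 2
        + ak * (ℓ₁ * (((d : ℝ) + 1) * ((C2 d + S * C1 d) * creg * e ^ β))
          * (2 + ℓ₁ * (((d : ℝ) + 1) * ((C2 d + S * C1 d) * creg * e ^ β))))) ≤ 1 / 2 := by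
  have hC1 := C1_nonneg d
  obtain ⟨e₁, he₁, h1⟩ := noCollar_threshold d (c := c) (aplus := aplus) hℓ₁ hc ha hcreg hβ S
  obtain ⟨e₂, he₂, h2⟩ := cube_threshold (C := 2 * ((d : ℝ) + 1) * C1 d * creg) (C' := 0) (t := 1)
    (by positivity) one_pos hβ
  refine ⟨min e₁ e₂, lt_min he₁ he₂, fun e he hle ak hak1 hak2 => ?_⟩
  obtain ⟨hθ1, hsm2, hsm⟩ := h1 e he (hle.trans (min_le_left _ _)) ak hak1 hak2
  have hT := (h2 e he (hle.trans (min_le_right _ _))).1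
  refine ⟨hθ1, ?_, hsm2, hsm⟩
  calc 2 * ((d : ℝ) + 1) * C1 d * creg * e ^ β = 2 * ((d : ℝ) + 1) * C1 d * creg * e ^ β := rfl
    _ ≤ 1 := hT

end Transverse

/-! ## §3. (2.16), the Hölder member, for `G_k(□, A)` at a (1.7)-regular `A` with NO collar -/

section Main

variable {ι : Type} [Fintype ι] [DecidableEq ι]

/-- the zero constant configuration is the zero bond function. [cite: Balaban1983RegularityDecay, p. 581 «constant configurations A₀», dictionary] -/
private theorem constBond_zero {X : Type*} (pos : X → Fin (d + 1) → ℤ) :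
    constBond (0 : Fin (d + 1) → ℝ) pos = 0 := by
  funext u v
  simp [constBond]

/-- **LEMMA 2.2 (2.16), THE HÖLDER MEMBER, FOR `G_k(□, A)` AT THE FIELD `A` ITSELF, (1.7)-REGULAR ON THE BOX, WITH NO
COLLAR** (the print's boundary-cube choice «Ã_j = A» on a parallelepiped): there is `C > 0` (for `0 ≤ α < 1`; Lemma
2.2 at charge `1`) such that for every regularity pair `(c, β)`, `β > 0`, and side bound `S` there is `e₁ > 0` with:
for every mesh `n = L^k`, every `a, m²` of the windows, every box `□ = Π_μ[0, nM_μ)` (`1 ≤ M_μ ≤ S`, `nM_μ ≥ 3`),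
EVERY component field `A` with `|A_ν(x + e_μ) − A_ν(x)| ≤ ce^{β−1}/n` for `x ∈ □` (nothing at the boundary), every
charge `0 < e ≤ e₁`, every direction `μ`, sites `x ≠ x′` whose forward `μ`-bonds lie in `□`, every nearest-neighbour
chain `Γ` from `x` to `x′` with `|Γ| ≤ (d+1)|x′ − x|_∞` and every `Φ`:
`(n/|x′ − x|_∞)^α·|U(A(Γ))(D^η_{A,μ}G_k(□,A)Φ)(x′) − (D^η_{A,μ}G_k(□,A)Φ)(x)| ≤ C‖Φ‖_∞` at coupling `e/n`
(corner embedding, staircase block contours).  Proof: §1 at `A₀ = 0`, `A' = (e/n)A''`, then the gauge step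
`A = (A'')^λ` (`holder_gauge`, `transport_gauge`, `covDeriv_gauge`, `b4Green_bondGauge`).
[cite: Balaban1983RegularityDecay, Lemma 2.2 (2.16) p. 577 with (2.14) p. 577, p. 579 «we can apply Lemma 2.2 to all operators in it», (1.7) p. 572, p. 581] -/
theorem lemma22_holder_noCollar (F : OrthFlow ι) {ℓ₁ : ℝ} (hℓ₁ : 0 ≤ ℓ₁)
    (hLip : ∀ t (v : ι → ℝ), ((F.U t - 1) *ᵥ v) ⬝ᵥ ((F.U t - 1) *ᵥ v) ≤ (ℓ₁ * t) ^ 2 * (v ⬝ᵥ v))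
    (d ℓ : ℕ) (hℓ : 1 ≤ ℓ) (amin aplus m2plus : ℝ) (ha : 0 < amin) (α : ℝ) (hα0 : 0 ≤ α) (hα1 : α < 1) :
    ∃ C : ℝ, 0 < C ∧ ∀ (creg β : ℝ), 0 ≤ creg → 0 < β → ∀ (S : ℕ),
      ∃ e₁ : ℝ, 0 < e₁ ∧ ∀ (k : ℕ), 1 ≤ k → ∀ (hn : 1 ≤ (ℓ + 1) ^ k) (a m2 : ℝ),
      amin ≤ a → a ≤ aplus → 0 ≤ m2 → m2 ≤ m2plus →
      ∀ (M : Fin (d + 1) → ℕ), (∀ i, 1 ≤ M i) → (∀ i, M i ≤ S) → (∀ i, 3 ≤ (ℓ + 1) ^ k * M i) →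
      ∀ (Ac : (Fin (d + 1) → ℤ) → Fin (d + 1) → ℝ) (e : ℝ), 0 < e → e ≤ e₁ →
        (∀ x ∈ Box d ℓ k M, ∀ μ ν : Fin (d + 1),
          |Ac (x + e1 μ) ν - Ac x ν| ≤ creg * e ^ (β - 1) / ((ℓ + 1) ^ k : ℕ)) →
      ∀ (μ : Fin (d + 1)) (x xe x' xe' : ↥(Box d ℓ k M)),
        xe.1 = x.1 + e1 μ → xe'.1 = x'.1 + e1 μ → x'.1 ≠ x.1 →
      ∀ (l : List ↥(Box d ℓ k M)), IsNNChain x l → pathEnd x l = x' →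
        (l.length : ℝ) ≤ ((d : ℝ) + 1) * supNorm (x'.1 - x.1) →
      ∀ Φ : ↥(Box d ℓ k M) × ι → ℝ,
        ((((ℓ + 1) ^ k : ℕ) : ℝ) / supNorm (x'.1 - x.1)) ^ α *
          siteNorm (transport (fieldLink F (e / ((ℓ + 1) ^ k : ℕ))
                (fun u v : ↥(Box d ℓ k M) => compField Ac u.1 v.1)) x l
              *ᵥ fld (derivA d F (e / ((ℓ + 1) ^ k : ℕ)) ℓ k M
                      (fun u v : ↥(Box d ℓ k M) => compField Ac u.1 v.1) μ
                    *ᵥ (greenA d F (e / ((ℓ + 1) ^ k : ℕ)) ℓ k a m2 M (baseEmb hn M) (stairContour hn M)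
                        (fun u v : ↥(Box d ℓ k M) => compField Ac u.1 v.1) *ᵥ Φ)) x'
            - fld (derivA d F (e / ((ℓ + 1) ^ k : ℕ)) ℓ k M
                      (fun u v : ↥(Box d ℓ k M) => compField Ac u.1 v.1) μ
                    *ᵥ (greenA d F (e / ((ℓ + 1) ^ k : ℕ)) ℓ k a m2 M (baseEmb hn M) (stairContour hn M)
                        (fun u v : ↥(Box d ℓ k M) => compField Ac u.1 v.1) *ᵥ Φ)) x)
          ≤ C * supN Φ := by
  obtain ⟨c, c₁, hc, hc₁, hL⟩ :=
    lemma22_16_holder_field_explicit_face F hℓ₁ hLip 1 d ℓ hℓ amin aplus m2plus ha α hα0 hα1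
  refine ⟨2 * c₁, by positivity, fun creg β hcreg hβ S => ?_⟩
  obtain ⟨e₁, he₁, hth⟩ := holder_noCollar_threshold d (c := c) (aplus := aplus) hℓ₁ hc.le ha hcreg hβ S
  refine ⟨e₁, he₁, ?_⟩
  intro k hk hn a m2 e1' e2 e3 e4 M hM hS hN3 Ac e he hle h17 μ x xe x' xe' hxe hxe' hne l hl hlend hlen Φ
  have hnr : (0 : ℝ) < ((ℓ + 1) ^ k : ℕ) := by exact_mod_cast hn
  obtain ⟨hak1, hak2⟩ := aSeq_window hℓ hk ha e1' e2
  obtain ⟨hθ1, hθT1, hsm2, hsm⟩ := hth e he hle _ hak1 hak2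
  obtain ⟨-, hA', hder, hface⟩ := gBond_hyps (d := d) hn hS hN3 hcreg he h17
  set n : ℕ := (ℓ + 1) ^ k with hn_def
  set A' : ↥(Box d ℓ k M) → ↥(Box d ℓ k M) → ℝ := gBond (e / n) (fun i => n * M i) Ac with hA'_def
  set θ : ℝ := (C2 d + S * C1 d) * creg * e ^ β with hθ_def
  set θ₂ : ℝ := C1 d * creg * e ^ β with hθ₂_def
  set θf : ℝ := C2 d * creg * e ^ β with hθf_def
  set θT : ℝ := 2 * ((d : ℝ) + 1) * C1 d * creg * e ^ β with hθT_def
  have hC1n := C1_nonneg d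
  have hC2n := C2_nonneg d
  have heβ : 0 < e ^ β := Real.rpow_pos_of_pos he β
  have hθ0 : 0 ≤ θ := by rw [hθ_def]; positivity
  have hθ₂0 : 0 ≤ θ₂ := by rw [hθ₂_def]; positivity
  have hθf0 : 0 ≤ θf := by rw [hθf_def]; positivity
  have hθT0 : 0 ≤ θT := by rw [hθT_def]; positivity
  have ha' : 0 < a := lt_of_lt_of_le ha e1'
  -- invertibility at the gauged field (any field: `opA_stair_isUnit_det`)
  have hunit : IsUnit (opA d F 1 ℓ k a m2 M (baseEmb hn M) (stairContour hn M)
      (constBond (0 : Fin (d + 1) → ℝ) Subtype.val + A')).det :=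
    opA_stair_isUnit_det F 1 hℓ hk hn ha' e3 M _
  -- the vacuous size of the zero constant part
  have hA0 : ∀ ν, |1 * (0 : Fin (d + 1) → ℝ) ν| ≤ θ / ((ℓ + 1) ^ k : ℕ) := fun ν => by
    rw [Pi.zero_apply, mul_zero, abs_zero]; positivity
  -- the transverse Lipschitz bound (§2) at charge `e/n`
  set κr : ℝ := creg * e ^ (β - 1) / n with hκr
  have hκr0 : 0 ≤ κr := by
    have := Real.rpow_pos_of_pos he (β - 1); rw [hκr]; positivity
  have hen : 0 < e / n := div_pos he hnr
  have hkey : e / n * κr = creg * e ^ β / (n : ℝ) ^ 2 := by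
    rw [hκr, Real.rpow_sub_one he.ne']
    field_simp
  have hA'' : ∀ (ν : Fin (d + 1)) (u ue u' ue' : ↥(Box d ℓ k M)), ue.1 = u.1 + e1 ν → ue'.1 = u'.1 + e1 ν →
      |1 * (A' u' ue' - A' u ue)| ≤ θT * supNorm (u'.1 - u.1) / (((ℓ + 1) ^ k : ℕ) : ℝ) ^ 2 := by
    intro ν u ue u' ue' hue hue'
    have hb := gauged_transverse hN3 hκr0 h17 ν u.2 (hue ▸ ue.2) u'.2 (hue' ▸ ue'.2)
    rw [one_mul, hA'_def, gBond_step hue', gBond_step hue, ← mul_sub, abs_mul, abs_of_pos hen]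
    calc e / n * |gauged (fun i => n * M i) Ac u'.1 ν - gauged (fun i => n * M i) Ac u.1 ν|
        ≤ e / n * (2 * (((d : ℝ) + 1) * supNorm (u'.1 - u.1)) * (C1 d * κr)) :=
          mul_le_mul_of_nonneg_left hb hen.le
      _ = 2 * ((d : ℝ) + 1) * C1 d * (e / n * κr) * supNorm (u'.1 - u.1) := by ring
      _ = θT * supNorm (u'.1 - u.1) / (n : ℝ) ^ 2 := by rw [hkey, hθT_def]; ring
  -- the contour sums along the staircases
  have hτ : ∀ y x, blkWt ((ℓ + 1) ^ k) M (fun i => (ℓ + 1) ^ k * M i) y x ≠ 0 →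
      |1 * lsum A' (baseEmb hn M y) (stairContour hn M y x)| ≤ ((d : ℝ) + 1) * θ :=
    fun y x _ => stair_lsum_le 1 hn M hθ0 hA' y x
  have hτ0 : 0 ≤ ((d : ℝ) + 1) * θ := by positivity
  -- the gauge that takes `A''` back to `A`
  set g : ↥(Box d ℓ k M) → Matrix ι ι ℝ := fun u => F.U (1 * gSig (e / n) (fun i => n * M i) Ac u) with hg_def
  have hg : IsGauge g := F.isGauge _
  -- the lineage's certificate at charge 1, constant part 0, fluctuation `A'`, source `𝒢ᵀΦ`
  have main := hL k hk a m2 e1' e2 e3 e4 M hM (baseEmb hn M) (stairContour hn M)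
    (fun y x hw => stairContour_end hn M y x hw) 0 A' θ θT θ₂ θf (((d : ℝ) + 1) * θ)
    hunit hθ0 hθ1 hA0 hA' hθT0 hθT1 hA'' hθ₂0 hder hθf0 hface hτ0 hτ hsm μ x xe x' xe' hxe hxe' hne l hl hlend hlen
    ((blockDiag g)ᵀ *ᵥ Φ)
  rw [constBond_zero, zero_add, supN_gauge_transpose hg] at main
  -- put back the charge and the gauge: `(e/n)A = (A')^{σ}`
  have hfield : (fun u v : ↥(Box d ℓ k M) => e / n * compField Ac u.1 v.1)
      = bondGauge (gSig (e / n) (fun i => n * M i) Ac) A' :=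
    (bondGauge_gBond (e / n) (fun i => n * M i) Ac).symm
  have hW : fieldLink F (e / n) (fun u v : ↥(Box d ℓ k M) => compField Ac u.1 v.1)
      = gaugeKer g g (fieldLink F 1 A') := by
    rw [fieldLink_smul, hfield, fieldLink_bondGauge]
  have hTr : transport (fieldLink F (e / n) (fun u v : ↥(Box d ℓ k M) => compField Ac u.1 v.1)) x l
      = g x * transport (fieldLink F 1 A') x l * (g x')ᵀ := by
    rw [hW, transport_gauge hg, hlend]
  have hDer : derivA d F (e / n) ℓ k M (fun u v : ↥(Box d ℓ k M) => compField Ac u.1 v.1) μ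
      = blockDiag g * derivA d F 1 ℓ k M A' μ * (blockDiag g)ᵀ := by
    unfold derivA
    rw [hW, covDeriv_gauge hg]
  have hGr : greenA d F (e / n) ℓ k a m2 M (baseEmb hn M) (stairContour hn M)
        (fun u v : ↥(Box d ℓ k M) => compField Ac u.1 v.1)
      = blockDiag g * greenA d F 1 ℓ k a m2 M (baseEmb hn M) (stairContour hn M) A' * (blockDiag g)ᵀ := by
    rw [greenA_smul, hfield]
    unfold greenA
    rw [b4Green_bondGauge F 1 _ m2 _ (fun y x hw => stairContour_end hn M y x hw)]
  rw [hTr, hDer, hGr, holder_gauge hg]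
  exact main

end Main

end

end Literature.MathematicalPhysics.QuantumFieldTheory.Balaban1983to89.B4Lemma22HolderNoCollar
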